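import Summits.QuantumFields.QCD.Theses.NestedDissectionSea
import Summits.QuantumFields.QCD.Theorems.CoerciveSea.Negative.PinWindow
import Literature.MathematicalPhysics.QuantumFieldTheory.QCDPhaseQuenchedPositivity
import Literature.Barriers.QuantumFields.WilsonDeterminantSign
import Mathlib

/-!
# Toolkit for the parity pins (b), (b″) of crux `EarlyCrosserLaw` (line `accretive-coarse-jensen`,
# stub `stub_pinnedLine`, item stmt-QuantumFields-13995)

The two pins of the crux are inequalities on the phase-quenched ratio

  `P_k,S(μ) := (∫ 𝟙[Re det D_W(U, μ, 1) < 0] · ∏_f ‖det D_W(U, m_f(k), 1)‖ dμ_W(β_k)) /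
              (∫ ∏_f ‖det D_W(U, m_f(k), 1)‖ dμ_W(β_k))`

on the odd four-torus of side `2S+1`, at the probe masses `μ = m_crit(k) ∓ a_k M / Z_m(k)`.
This file records, hypothesis-free and for every torus side `L ≥ 1`, every `β`, every mass tuple:

* `pinnedLine_measurableSet_re_fermionDet_neg` (+ `_isOpen_`, `_continuous_`): the pin event
  `{U | Re det D_W(U, μ, 1) < 0}` is OPEN, hence Borel measurable;
* `pinnedLine_re_fermionDet_neg_iff_odd_index`: the pin event is EXACTLY "`det ≠ 0` and the
  spectral index `Q(U, μ) = n₋(Γ₅ D_W) − n/2` is odd" (the proved barrier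
  `WilsonDeterminantSign_holds`, instantiated at `SU(3)`, fundamental, `r = 1`);
* `pinnedLine_den_pos`: the denominator is `> 0` ALWAYS (constant twisted field,
  `integral_norm_det_diracMatrix_pos_all`) — the pins have no `x / 0` junk case;
* `pinnedLine_ratio_eq_measureReal`: the ratio of ANY measurable event `E` is the probability
  `(qcdLatticeMeasure L β mq).real {U | E U}` under the phase-quenched probability measure of
  `QCD.lean`; hence `pinnedLine_ratio_nonneg`, `pinnedLine_ratio_le_one`,
  `pinnedLine_ratio_add_ratio_not` (complement rule: `P(E) + P(¬E) = 1`);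
* `pinnedLine_ratio_re_neg_eq_zero_of_nonneg_or_le`: the pin ratio vanishes at every probe mass
  `μ ∉ (−8, 0)` (closure of Seiler positivity, `fermionDet_wilsonDirac_re_nonneg`).

Everything is standard material [folklore]; no Theses statement is asserted.
-/

noncomputable section

open scoped BigOperators Matrix ComplexConjugate
open Filter MeasureTheory
open Literature.MathematicalPhysics.QuantumLattice Literature.MathematicalPhysics.QuantumFieldTheory
  Literature.Probability.LatticeModels
open Literature.Barriers.QuantumFields
open Summit.QuantumFields.QCD.Theses.NestedDissectionSea
open Summit.QuantumFields.QCD.Theorems.CoerciveSeaNegative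

namespace Summit.QuantumFields.QCD.Cruxes.EarlyCrosserLaw.AccretiveCoarseJensen

-- The colour group is written `SU3` (`= Matrix.specialUnitaryGroup (Fin 3) ℂ`, the abbreviation of
-- `QCD.lean`), definitionally the skeleton's local notation for `SU(3)`.

/-! ## The pin event is open and measurable -/

/-- `U ↦ Re det D_W(U, μ, 1)` is continuous on the configuration space of any torus (a polynomial in
the link entries). [folklore] -/
theorem pinnedLine_continuous_re_fermionDet (L : ℕ) [NeZero L] (μ : ℝ) :
    Continuous fun U : GaugeConfig 4 L SU3 =>
      (fermionDet (wilsonDirac (fundamentalRep (Fin 3)) U μ 1)).re :=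
  Complex.continuous_re.comp
    (continuous_wilsonDirac (fundamentalRep (Fin 3)) (continuous_fundamentalRep (Fin 3)) μ 1).matrix_det

/-- The pin event `{U | Re det D_W(U, μ, 1) < 0}` is OPEN. [folklore] -/
theorem pinnedLine_isOpen_re_fermionDet_neg (L : ℕ) [NeZero L] (μ : ℝ) :
    IsOpen {U : GaugeConfig 4 L SU3 | (fermionDet (wilsonDirac (fundamentalRep (Fin 3)) U μ 1)).re < 0} :=
  isOpen_lt (pinnedLine_continuous_re_fermionDet L μ) continuous_const

/-- **The pin event `{U | Re det D_W(U, μ, 1) < 0}` is Borel measurable**, on every torus, for every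
bare mass (it is open). [folklore] -/
theorem pinnedLine_measurableSet_re_fermionDet_neg (L : ℕ) [NeZero L] (μ : ℝ) :
    MeasurableSet {U : GaugeConfig 4 L SU3 | (fermionDet (wilsonDirac (fundamentalRep (Fin 3)) U μ 1)).re < 0} :=
  (pinnedLine_isOpen_re_fermionDet_neg L μ).measurableSet

/-! ## The pin event is the odd-index event -/

/-- **Parity dictionary** (the barrier `WilsonDeterminantSign_holds` at `SU(3)`, fundamental,
`r = 1`): `Re det D_W(U, μ, 1) < 0` iff `det D_W(U, μ, 1) ≠ 0` and the spectral index
`Q(U, μ) = n₋(Γ₅ D_W(U, μ, 1)) − n/2` is odd. So both pins are statements about the phase-quenched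
probability of `{det ≠ 0 ∧ Q odd}`. [folklore] -/
theorem pinnedLine_re_fermionDet_neg_iff_odd_index {L : ℕ} [NeZero L] (U : GaugeConfig 4 L SU3) (μ : ℝ) :
    (fermionDet (wilsonDirac (fundamentalRep (Fin 3)) U μ 1)).re < 0 ↔
      fermionDet (wilsonDirac (fundamentalRep (Fin 3)) U μ 1) ≠ 0 ∧
        Odd (WilsonDeterminant.wilsonSpectralIndex (fundamentalRep (Fin 3))
          fundamentalRep_mem_unitaryGroup U μ 1) := by
  constructor
  · intro h
    have hne : fermionDet (wilsonDirac (fundamentalRep (Fin 3)) U μ 1) ≠ 0 := by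
      intro h0
      rw [h0, Complex.zero_re] at h
      exact lt_irrefl _ h
    exact ⟨hne, (WilsonDeterminantSign_holds L 3 SU3 (fundamentalRep (Fin 3))
      fundamentalRep_mem_unitaryGroup U μ 1 hne).mp h⟩
  · rintro ⟨hne, hodd⟩
    exact (WilsonDeterminantSign_holds L 3 SU3 (fundamentalRep (Fin 3))
      fundamentalRep_mem_unitaryGroup U μ 1 hne).mpr hodd

/-- Set form of the parity dictionary. [folklore] -/
theorem pinnedLine_setOf_re_fermionDet_neg_eq {L : ℕ} [NeZero L] (μ : ℝ) :
    {U : GaugeConfig 4 L SU3 | (fermionDet (wilsonDirac (fundamentalRep (Fin 3)) U μ 1)).re < 0} =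
      {U | fermionDet (wilsonDirac (fundamentalRep (Fin 3)) U μ 1) ≠ 0 ∧
        Odd (WilsonDeterminant.wilsonSpectralIndex (fundamentalRep (Fin 3))
          fundamentalRep_mem_unitaryGroup U μ 1)} :=
  Set.ext fun U => pinnedLine_re_fermionDet_neg_iff_odd_index U μ

/-! ## The phase-quenched ratio is a probability -/

/-- **The denominator of the pins is positive, always**: `0 < ∫ ∏_f ‖det D_W(U, m_f, 1)‖ dμ_W(β)`
for every torus side `L ≥ 1`, every `β`, every mass tuple (the constant twisted `SU(3)` field has
`det ≠ 0` at every mass and the Wilson measure charges open sets —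
`integral_norm_det_diracMatrix_pos_all`). No `x / 0` junk case in (b), (b″). [folklore] -/
theorem pinnedLine_den_pos {Nf : ℕ} (L : ℕ) [NeZero L] (β : ℝ) (mq : Fin Nf → ℝ) :
    0 < ∫ U, (∏ f, ‖fermionDet (wilsonDirac (fundamentalRep (Fin 3)) U (mq f) 1)‖)
      ∂(wilsonMeasure (fundamentalRep (Fin 3)) β : Measure (GaugeConfig 4 L SU3)) := by
  have h := integral_norm_det_diracMatrix_pos_all (S := L) β mq
  simp_rw [norm_det_diracMatrix] at h
  exact h

/-- The ratio of an event `E` IS the phase-quenched expectation `⟨𝟙_E⟩₊` of `QCDPhaseQuenched.lean`.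
[folklore] -/
theorem pinnedLine_ratio_eq_qcdPhaseQuenchedExpect {Nf : ℕ} (L : ℕ) [NeZero L] (β : ℝ)
    (mq : Fin Nf → ℝ) (E : GaugeConfig 4 L SU3 → Prop) [DecidablePred E] :
    (∫ U, (if E U then (1 : ℝ) else 0) * (∏ f, ‖fermionDet (wilsonDirac (fundamentalRep (Fin 3)) U (mq f) 1)‖)
        ∂(wilsonMeasure (fundamentalRep (Fin 3)) β : Measure (GaugeConfig 4 L SU3))) /
      (∫ U, (∏ f, ‖fermionDet (wilsonDirac (fundamentalRep (Fin 3)) U (mq f) 1)‖)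
        ∂(wilsonMeasure (fundamentalRep (Fin 3)) β : Measure (GaugeConfig 4 L SU3))) =
      qcdPhaseQuenchedExpect β L mq (fun U => if E U then (1 : ℝ) else 0) :=
  (qcdPhaseQuenchedExpect_eq_div_prod β mq _).symm

/-- **The ratio of a measurable event is its probability under the phase-quenched probability
measure** `qcdLatticeMeasure L β mq` of `QCD.lean` (`Z⁻¹ e^{−β S_W} ∏_f |det D_W(m_f)| ∏ dU`).
[folklore] -/
theorem pinnedLine_ratio_eq_measureReal {Nf : ℕ} (L : ℕ) [NeZero L] (β : ℝ)
    (mq : Fin Nf → ℝ) (E : GaugeConfig 4 L SU3 → Prop) [DecidablePred E]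
    (hE : MeasurableSet {U | E U}) :
    (∫ U, (if E U then (1 : ℝ) else 0) * (∏ f, ‖fermionDet (wilsonDirac (fundamentalRep (Fin 3)) U (mq f) 1)‖)
        ∂(wilsonMeasure (fundamentalRep (Fin 3)) β : Measure (GaugeConfig 4 L SU3))) /
      (∫ U, (∏ f, ‖fermionDet (wilsonDirac (fundamentalRep (Fin 3)) U (mq f) 1)‖)
        ∂(wilsonMeasure (fundamentalRep (Fin 3)) β : Measure (GaugeConfig 4 L SU3))) =
      (qcdLatticeMeasure L β mq).real {U | E U} := by
  rw [pinnedLine_ratio_eq_qcdPhaseQuenchedExpect, qcdPhaseQuenchedExpect_eq_integral_qcdLatticeMeasure,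
    ← integral_indicator_one hE]
  refine integral_congr_ae (Eventually.of_forall fun U => ?_)
  simp only [Set.indicator_apply, Set.mem_setOf_eq, Pi.one_apply]

/-- The ratio of any event is `≥ 0`. [folklore] -/
theorem pinnedLine_ratio_nonneg {Nf : ℕ} (L : ℕ) [NeZero L] (β : ℝ)
    (mq : Fin Nf → ℝ) (E : GaugeConfig 4 L SU3 → Prop) [DecidablePred E] :
    0 ≤ (∫ U, (if E U then (1 : ℝ) else 0) * (∏ f, ‖fermionDet (wilsonDirac (fundamentalRep (Fin 3)) U (mq f) 1)‖)
        ∂(wilsonMeasure (fundamentalRep (Fin 3)) β : Measure (GaugeConfig 4 L SU3))) /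
      (∫ U, (∏ f, ‖fermionDet (wilsonDirac (fundamentalRep (Fin 3)) U (mq f) 1)‖)
        ∂(wilsonMeasure (fundamentalRep (Fin 3)) β : Measure (GaugeConfig 4 L SU3))) := by
  refine div_nonneg (integral_nonneg fun U => ?_) (integral_nonneg fun U => ?_)
  · exact mul_nonneg (by split_ifs <;> norm_num) (Finset.prod_nonneg fun f _ => norm_nonneg _)
  · exact Finset.prod_nonneg fun f _ => norm_nonneg _

/-- The ratio of any event is `≤ 1`. [folklore] -/
theorem pinnedLine_ratio_le_one {Nf : ℕ} (L : ℕ) [NeZero L] (β : ℝ)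
    (mq : Fin Nf → ℝ) (E : GaugeConfig 4 L SU3 → Prop) [DecidablePred E] :
    (∫ U, (if E U then (1 : ℝ) else 0) * (∏ f, ‖fermionDet (wilsonDirac (fundamentalRep (Fin 3)) U (mq f) 1)‖)
        ∂(wilsonMeasure (fundamentalRep (Fin 3)) β : Measure (GaugeConfig 4 L SU3))) /
      (∫ U, (∏ f, ‖fermionDet (wilsonDirac (fundamentalRep (Fin 3)) U (mq f) 1)‖)
        ∂(wilsonMeasure (fundamentalRep (Fin 3)) β : Measure (GaugeConfig 4 L SU3))) ≤ 1 := by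
  rw [div_le_one (pinnedLine_den_pos L β mq)]
  refine integral_mono_of_nonneg (Eventually.of_forall fun U => ?_) ?_ (Eventually.of_forall fun U => ?_)
  · exact mul_nonneg (by split_ifs <;> norm_num) (Finset.prod_nonneg fun f _ => norm_nonneg _)
  · have := integrable_norm_det_diracMatrix (S := L) mq
      (wilsonMeasure (fundamentalRep (Fin 3)) β : Measure (GaugeConfig 4 L SU3))
    simp_rw [norm_det_diracMatrix] at this
    exact this
  · have h0 : 0 ≤ ∏ f, ‖fermionDet (wilsonDirac (fundamentalRep (Fin 3)) U (mq f) 1)‖ :=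
      Finset.prod_nonneg fun f _ => norm_nonneg _
    show (if E U then (1 : ℝ) else 0) * _ ≤ _
    split_ifs <;> nlinarith

/-- **Complement rule**: for a measurable event, `P(E) + P(¬E) = 1` (the denominator is positive,
so the phase-quenched measure is a probability measure). In particular the upper pin
`P(Re det < 0) ≤ 1/8` is `P(0 ≤ Re det) ≥ 7/8`. [folklore] -/
theorem pinnedLine_ratio_add_ratio_not {Nf : ℕ} (L : ℕ) [NeZero L] (β : ℝ)
    (mq : Fin Nf → ℝ) (E : GaugeConfig 4 L SU3 → Prop) [DecidablePred E]
    (hE : MeasurableSet {U | E U}) :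
    (∫ U, (if E U then (1 : ℝ) else 0) * (∏ f, ‖fermionDet (wilsonDirac (fundamentalRep (Fin 3)) U (mq f) 1)‖)
        ∂(wilsonMeasure (fundamentalRep (Fin 3)) β : Measure (GaugeConfig 4 L SU3))) /
      (∫ U, (∏ f, ‖fermionDet (wilsonDirac (fundamentalRep (Fin 3)) U (mq f) 1)‖)
        ∂(wilsonMeasure (fundamentalRep (Fin 3)) β : Measure (GaugeConfig 4 L SU3))) +
    (∫ U, (if ¬ E U then (1 : ℝ) else 0) * (∏ f, ‖fermionDet (wilsonDirac (fundamentalRep (Fin 3)) U (mq f) 1)‖)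
        ∂(wilsonMeasure (fundamentalRep (Fin 3)) β : Measure (GaugeConfig 4 L SU3))) /
      (∫ U, (∏ f, ‖fermionDet (wilsonDirac (fundamentalRep (Fin 3)) U (mq f) 1)‖)
        ∂(wilsonMeasure (fundamentalRep (Fin 3)) β : Measure (GaugeConfig 4 L SU3))) = 1 := by
  haveI := isProbabilityMeasure_qcdLatticeMeasure_all (S := L) β mq
  rw [pinnedLine_ratio_eq_measureReal L β mq E hE,
    pinnedLine_ratio_eq_measureReal L β mq (fun U => ¬ E U) hE.compl]
  have hc : {U : GaugeConfig 4 L SU3 | ¬ E U} = {U | E U}ᶜ := rfl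
  rw [hc, measureReal_add_measureReal_compl hE, probReal_univ]

/-! ## The pin ratio vanishes off the Wilson band -/

/-- **Off `(−8, 0)` the pin ratio is `0`**: at a probe mass `μ ≥ 0` or `μ ≤ −8` one has
`Re det D_W(U, μ, 1) ≥ 0` for EVERY gauge field (`fermionDet_wilsonDirac_re_nonneg`), the indicator
vanishes identically and the ratio is `0 / den = 0`. [folklore] -/
theorem pinnedLine_ratio_re_neg_eq_zero_of_nonneg_or_le {Nf : ℕ} (L : ℕ) [NeZero L] (β : ℝ)
    (mq : Fin Nf → ℝ) {μ : ℝ} (hμ : 0 ≤ μ ∨ μ ≤ -8) :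
    (∫ U, (if (fermionDet (wilsonDirac (fundamentalRep (Fin 3)) U μ 1)).re < 0 then (1 : ℝ) else 0) *
        (∏ f, ‖fermionDet (wilsonDirac (fundamentalRep (Fin 3)) U (mq f) 1)‖)
        ∂(wilsonMeasure (fundamentalRep (Fin 3)) β : Measure (GaugeConfig 4 L SU3))) /
      (∫ U, (∏ f, ‖fermionDet (wilsonDirac (fundamentalRep (Fin 3)) U (mq f) 1)‖)
        ∂(wilsonMeasure (fundamentalRep (Fin 3)) β : Measure (GaugeConfig 4 L SU3))) = 0 := by
  have hzero : ∀ U : GaugeConfig 4 L SU3,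
      ¬ (fermionDet (wilsonDirac (fundamentalRep (Fin 3)) U μ 1)).re < 0 := fun U =>
    not_lt.mpr (fermionDet_wilsonDirac_re_nonneg _ fundamentalRep_mem_unitaryGroup U hμ)
  simp only [hzero, if_false, zero_mul, integral_zero, zero_div]

end Summit.QuantumFields.QCD.Cruxes.EarlyCrosserLaw.AccretiveCoarseJensen

end
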